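import Summits.ValiantsHypothesis.ValiantsHypothesis.Theorems.DivisionGapPerDivisionHardStubSparseRigidCount

/-!
# Crux `DivisionGap.PerDivisionHard` (stmt-ValiantsHypothesis-5065), line `pair-descent-jss-endpoint` —
stub `stub_blockFits`: the block `G(b,k) ⊕ M₀` fits into `n` rows (polylog bookkeeping)

`stub_blockFits`: with `b = (log₂ n + d)^d` and any `k` with `k² ≤ n`, the `b + b·(b·k)`
non-padding labels of the block arsenal fit into `n` rows for all large `n`.

Proof.  Let `L = log₂ n`, `s = Nat.sqrt n` (so `k ≤ s` and `s² ≤ n`).  From `growth (2d)`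
(`StubSparseRigidCount.lean`): `16 q³ ≤ 2^L ≤ n` with `q = (L + 2d + 1)^{2d+1} ≥ b²`, hence
`(2b²)² = 4 b⁴ ≤ n`, i.e. `2 b² ≤ s`.  Then `b + b² k ≤ b² s + b² s = 2 b² s ≤ s² ≤ n`
(`b ≤ b² ≤ b⁴ ≤ 2 b⁴ ≤ b² s`).
-/

noncomputable section

-- `Summit.ValiantsHypothesis.ValiantsHypothesis.…` is the tree's mandated single-conjunct layout
-- (Sub = Summit), so the duplicated namespace component is intended.
set_option linter.dupNamespace false

namespace Summit.ValiantsHypothesis.ValiantsHypothesis.Theorems.DivisionGapPerDivisionHard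

/-- Polylog bookkeeping: `(2 b²)² ≤ n` for `b = (log₂ n + d)^d` and all large `n` (from `growth`:
`16 q³ ≤ 2^{log₂ n}` with `q = (log₂ n + 2d + 1)^{2d+1} ≥ b²`). [folklore] -/
theorem two_mul_logPow_sq_le (d : ℕ) : ∃ n₀ : ℕ, ∀ n ≥ n₀,
    2 * ((Nat.log 2 n + d) ^ d * (Nat.log 2 n + d) ^ d) *
      (2 * ((Nat.log 2 n + d) ^ d * (Nat.log 2 n + d) ^ d)) ≤ n := by
  obtain ⟨L₀, hL₀⟩ := growth (2 * d)
  refine ⟨2 ^ L₀, fun n hn => ?_⟩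
  have hn0 : n ≠ 0 := by
    have : 1 ≤ 2 ^ L₀ := Nat.one_le_two_pow
    omega
  have hL : L₀ ≤ Nat.log 2 n := Nat.le_log_of_pow_le one_lt_two hn
  have h2L : 2 ^ Nat.log 2 n ≤ n := Nat.pow_log_le_self 2 hn0
  have hq := hL₀ (Nat.log 2 n) hL
  set L := Nat.log 2 n with hLdef
  set q := (L + 2 * d + 1) ^ (2 * d + 1) with hqdef
  set b := (L + d) ^ d with hbdef
  have hq1 : 1 ≤ q := Nat.one_le_pow _ _ (by omega)
  have hbq : b * b ≤ q :=
    calc b * b = (L + d) ^ (d + d) := (pow_add _ _ _).symm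
      _ ≤ (L + 2 * d + 1) ^ (d + d) := Nat.pow_le_pow_left (by omega) _
      _ ≤ (L + 2 * d + 1) ^ (2 * d + 1) := Nat.pow_le_pow_right (by omega) (by omega)
  have hqq : q * q ≤ q * (q * q) := Nat.mul_le_mul_left q (Nat.le_mul_of_pos_left q hq1)
  calc 2 * (b * b) * (2 * (b * b)) = 4 * (b * b * (b * b)) := by ring
    _ ≤ 4 * (q * q) := Nat.mul_le_mul_left 4 (Nat.mul_le_mul hbq hbq)
    _ ≤ 16 * (q * (q * q)) := Nat.mul_le_mul (by norm_num) hqq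
    _ ≤ 2 ^ L := hq
    _ ≤ n := h2L

/-- **`stub_blockFits` (polylog bookkeeping).**  For `b = (log₂ n + d)^d` and every `k` with
`k² ≤ n`, the block `G(b,k)` fits: `b + b·(b·k) ≤ n` for all large `n` (`k ≤ √n` and
`2 b² ≤ √n` by `two_mul_logPow_sq_le`, so `b + b² k ≤ 2 b² √n ≤ n`). [folklore] -/
theorem stub_blockFits :
    ∀ d : ℕ, ∃ n₀ : ℕ, ∀ n ≥ n₀, ∀ k : ℕ, k * k ≤ n →
      (Nat.log 2 n + d) ^ d + (Nat.log 2 n + d) ^ d * ((Nat.log 2 n + d) ^ d * k) ≤ n := by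
  intro d
  obtain ⟨n₀, hn₀⟩ := two_mul_logPow_sq_le d
  refine ⟨n₀, fun n hn k hk => ?_⟩
  have h4 := hn₀ n hn
  set b := (Nat.log 2 n + d) ^ d with hbdef
  set s := Nat.sqrt n with hsdef
  have hks : k ≤ s := Nat.le_sqrt.mpr hk
  have h2 : 2 * (b * b) ≤ s := Nat.le_sqrt.mpr h4
  have hs : s * s ≤ n := Nat.sqrt_le n
  have hb : b ≤ b * b * s :=
    calc b ≤ b * b := Nat.le_mul_self b
      _ ≤ b * b * (b * b) := Nat.le_mul_self _
      _ ≤ b * b * (2 * (b * b)) := Nat.mul_le_mul_left _ (Nat.le_mul_of_pos_left _ two_pos)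
      _ ≤ b * b * s := Nat.mul_le_mul_left _ h2
  calc b + b * (b * k) = b + b * b * k := by rw [Nat.mul_assoc]
    _ ≤ b * b * s + b * b * s := Nat.add_le_add hb (Nat.mul_le_mul_left _ hks)
    _ = 2 * (b * b) * s := by ring
    _ ≤ s * s := Nat.mul_le_mul_right s h2
    _ ≤ n := hs

end Summit.ValiantsHypothesis.ValiantsHypothesis.Theorems.DivisionGapPerDivisionHard

end
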